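import Summits.NavierStokesRegularity.NavierStokesRegularity.Theorems.LerayQuarterDissipationFiniteDissipationLiouvilleThresholdLimit
import HarnessLib

/-!
# Crux `FiniteDissipationLiouville` (stmt-NavierStokesRegularity-22144): STRETCHING SATURATION — for
# every Type-I constant `C`, the finite-dissipation stratum contains, in the scaling hull of each
# singular member, a singular member whose slice is a NEAR-EXTREMAL of the stretching inequality,
# with defect `≤ ½ (C² − 1)⁺ · ‖curlCLM‖² K`

Theorems file of route `LerayQuarterDissipation` (lead prover g14; `--supports` the crux; the
general-`C` form of the THRESHOLD-ONE chain). Navier–Stokes regularity is NOT proved by anything here;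
no summit is. `U = lerayOrbit V`, `Ω = curl U`, `φ_R = smoothTransition(2 − ‖y‖²/R²)`, slack
`σ_R = 2∫φ_R(C − ‖U‖)‖DΩ Ω‖ ≥ 0` (`…ThresholdBudget`), `M(K) = ‖curlCLM‖²·max K 0` the class bound on
the similarity enstrophy (`SmallDissipationGap.integrable_sq_norm_lerayVorticity`).

* `exists_slack_lt_general` — for a member of `𝒟_{C,K}` (any `C`), every `R ≥ 1` and `ε > 0`, some
  similarity time has `σ_R(s) < ½(C²−1)⁺ M(K) + L M(K)/R + ε` (the budget with slack:
  `Z_R' ≤ −½(1−C²)Z_R + (L/R)∫_{B̄_{2R}}‖Ω‖² − σ_R`, `Z_R ≤ M(K)`; `Z_R ≥ 0` cannot fall at a fixed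
  rate forever).
* `exists_singular_limit_slack_le` — **STRETCHING SATURATION**: a singular member `W ∈ 𝒟_{C,K}` has
  rescalings `λ_k W(λ_k²·, λ_k·)` converging pointwise on the past to a SINGULAR `V ∈ 𝒟_{C,K}` with
  `2∫φ_R(C − ‖V(−1)‖)‖D(curl V(−1))[curl V(−1)]‖ ≤ ½(C²−1)⁺ M(K)` for EVERY `R > 0`: the slice of `V` is
  a near-extremal of the stretching step `|⟪U, DΩ Ω⟫| ≤ C‖DΩ Ω‖` of the similarity enstrophy budget,
  the defect being controlled by the excess of the Type-I constant over the law-free threshold. At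
  `C ≤ 1` the defect is `0` and `…ThresholdOne` turns this into a contradiction; for `C > 1` it is a
  quantitative PORTRAIT constraint on the residue (critical elements: `‖U‖` is close to `C` wherever the
  vortex-line curvature term `DΩ Ω` is not small, in `L¹`-mean).

HONEST FRAMING: portrait for `C > 1` (no exclusion); constants `L`, `M(K)` explicit but the near-extremal
element is produced by compactness.

References: KNSS, arXiv:0709.3599 §4; the tree's T31⁗ budget; `…ThresholdLimit`.
-/

noncomputable section

set_option linter.dupNamespace false

namespace Summit.NavierStokesRegularity.NavierStokesRegularity.Theorems.FiniteDissipationLiouville.ThresholdOne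

open MeasureTheory Set Filter Topology Metric InnerProductSpace Function Real
open scoped RealInnerProductSpace ContDiff
open Literature.Analysis Literature.Analysis.FluidPDE
open Summit.NavierStokesRegularity.NavierStokesRegularity.Theorems
open Summit.NavierStokesRegularity.NavierStokesRegularity.Theorems.GaussianGap
open Summit.NavierStokesRegularity.NavierStokesRegularity.Theorems.FiniteDissipationLiouville

/-! ### The slack is somewhere small, for every Type-I constant -/

/-- **For every `C`, under the law, the slack is somewhere `≤ ½(C²−1)⁺M(K) + O(1/R)`.** Let
`V ∈ 𝒟_{C,K}`. There is `L ≥ 0` such that for every `R ≥ 1` and `ε > 0` some similarity time `s` has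
`2∫φ_R(C − ‖U(s)‖)‖DΩ(s) Ω(s)‖ < ½ max(C²−1, 0)·M + L M/R + ε`, `M = ‖curlCLM‖²·max K 0`
(`deriv_cutoffEnstrophy_le_sub_slack`, `Z_R ≤ ∫‖Ω‖² ≤ M`, and `Z_R ≥ 0` cannot decrease at rate `ε`
forever). [cite: KochNadirashviliSereginSverak2009, §4 (arXiv:0709.3599 p. 8)] -/
theorem exists_slack_lt_general {C : ℝ} {V : ℝ → EuclideanSpace ℝ (Fin 3) → EuclideanSpace ℝ (Fin 3)}
    (hV : IsTypeIAncientMild C V) {K : ℝ}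
    (hlaw : ∀ t : ℝ, t < 0 → ∫⁻ x, ‖fderiv ℝ (V t) x‖ₑ ^ 2 ≤ ENNReal.ofReal (K / Real.sqrt (-t))) :
    ∃ L : ℝ, 0 ≤ L ∧ ∀ R : ℝ, 1 ≤ R → ∀ ε : ℝ, 0 < ε → ∃ s : ℝ,
      2 * (∫ y, smoothTransition (2 - ‖y‖ ^ 2 / R ^ 2) *
        ((C - ‖lerayOrbit V s y‖) * ‖fderiv ℝ (lerayVorticity V s) y (lerayVorticity V s y)‖)) <
        (1 / 2) * max (C ^ 2 - 1) 0 * (‖curlCLM‖ ^ 2 * max K 0) +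
          L * (‖curlCLM‖ ^ 2 * max K 0) / R + ε := by
  obtain ⟨L, hL0, hbudget⟩ := deriv_cutoffEnstrophy_le_sub_slack hV
  set M : ℝ := ‖curlCLM‖ ^ 2 * max K 0 with hMdef
  have hM0 : 0 ≤ M := by positivity
  have hM : ∀ s : ℝ, Integrable (fun y => ‖lerayVorticity V s y‖ ^ 2) ∧
      ∫ y, ‖lerayVorticity V s y‖ ^ 2 ≤ M := fun s =>
    SmallDissipationGap.integrable_sq_norm_lerayVorticity hV hlaw s
  refine ⟨L, hL0, fun R hR1 ε hε => ?_⟩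
  have hR : 0 < R := lt_of_lt_of_le one_pos hR1
  by_contra hcon
  push Not at hcon
  set Z : ℝ → ℝ := fun σ => ∫ y, smoothTransition (2 - ‖y‖ ^ 2 / R ^ 2) * ‖lerayVorticity V σ y‖ ^ 2
    with hZdef
  have hZd : ∀ s, DifferentiableAt ℝ Z s := fun s =>
    (signedBudget_hasDerivAt_cutoffEnstrophy hV hR s).differentiableAt
  have hZ0 : ∀ s, 0 ≤ Z s := fun s =>
    integral_nonneg fun y => mul_nonneg (smoothTransition_cutoff_nonneg R y) (sq_nonneg _)
  -- `Z_R ≤ M` and `∫_{B̄_{2R}} ‖Ω‖² ≤ M`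
  have hZM : ∀ s, Z s ≤ M := by
    intro s
    have h1 : Z s ≤ ∫ y, ‖lerayVorticity V s y‖ ^ 2 := by
      refine integral_mono_of_nonneg (Eventually.of_forall fun y =>
        mul_nonneg (smoothTransition_cutoff_nonneg R y) (sq_nonneg _)) (hM s).1
        (Eventually.of_forall fun y => ?_)
      have hφ1 := smoothTransition_cutoff_le_one R y
      have : 0 ≤ ‖lerayVorticity V s y‖ ^ 2 := sq_nonneg _
      nlinarith
    exact h1.trans (hM s).2
  have hI : ∀ s, (∫ y in closedBall (0 : EuclideanSpace ℝ (Fin 3)) (2 * R), ‖lerayVorticity V s y‖ ^ 2)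
      ≤ M := fun s =>
    (setIntegral_le_integral (hM s).1 (Eventually.of_forall fun y => sq_nonneg _)).trans (hM s).2
  have hZ' : ∀ s, deriv Z s ≤ -ε := by
    intro s
    have hb := hbudget R hR1 s
    have hslack := hcon s
    have hfirst : -((1 / 2) * (1 - C ^ 2)) *
        (∫ y, smoothTransition (2 - ‖y‖ ^ 2 / R ^ 2) * ‖lerayVorticity V s y‖ ^ 2) ≤
        (1 / 2) * max (C ^ 2 - 1) 0 * M := by
      have hZs := hZ0 s
      have hZMs := hZM s
      simp only [hZdef] at hZs hZMs
      have hmax : C ^ 2 - 1 ≤ max (C ^ 2 - 1) 0 := le_max_left _ _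
      have hmax0 : 0 ≤ max (C ^ 2 - 1) 0 := le_max_right _ _
      calc -((1 / 2) * (1 - C ^ 2)) *
            (∫ y, smoothTransition (2 - ‖y‖ ^ 2 / R ^ 2) * ‖lerayVorticity V s y‖ ^ 2)
          = (1 / 2) * (C ^ 2 - 1) *
            (∫ y, smoothTransition (2 - ‖y‖ ^ 2 / R ^ 2) * ‖lerayVorticity V s y‖ ^ 2) := by ring
        _ ≤ (1 / 2) * max (C ^ 2 - 1) 0 *
            (∫ y, smoothTransition (2 - ‖y‖ ^ 2 / R ^ 2) * ‖lerayVorticity V s y‖ ^ 2) := by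
            gcongr
        _ ≤ (1 / 2) * max (C ^ 2 - 1) 0 * M := by gcongr
    have hsecond : L / R * (∫ y in closedBall (0 : EuclideanSpace ℝ (Fin 3)) (2 * R),
        ‖lerayVorticity V s y‖ ^ 2) ≤ L * M / R := by
      rw [show L * M / R = L / R * M by ring]
      exact mul_le_mul_of_nonneg_left (hI s) (div_nonneg hL0 hR.le)
    show deriv Z s ≤ -ε
    simp only [hZdef]
    linarith
  have hdiff : Differentiable ℝ Z := hZd
  set s₁ : ℝ := Z 0 / ε + 1 with hs₁
  have hs₁pos : 0 < s₁ := by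
    have : 0 ≤ Z 0 / ε := div_nonneg (hZ0 0) hε.le
    linarith
  have hmvt : Z s₁ - Z 0 ≤ -ε * (s₁ - 0) := image_sub_le_mul_sub_of_deriv_le hdiff hZ' hs₁pos.le
  have hneg : Z s₁ < 0 := by
    have e : -ε * (s₁ - 0) = -(Z 0) - ε := by
      rw [hs₁]; field_simp; ring
    rw [e] at hmvt
    linarith
  exact absurd (hZ0 s₁) (not_le.2 hneg)

/-! ### Stretching saturation on a singular limit -/

/-- **STRETCHING SATURATION.** A singular member `W ∈ 𝒟_{C,K}` has rescalings
`λ_k W(λ_k² ·, λ_k ·)` converging pointwise on the past (KNSS compactness) to a SINGULAR member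
`V ∈ 𝒟_{C,K}` whose slice `t = −1` is a near-extremal of the stretching step: for every `R > 0`,
`2∫φ_R(C − ‖V(−1,y)‖)‖D(curl V(−1,·))(y)[curl V(−1,·)(y)]‖ dy ≤ ½ max(C²−1,0)·‖curlCLM‖²·max K 0`.
At `C ≤ 1` the right side is `0` (`…ThresholdLimit` / `…ThresholdOne`). [cite: KochNadirashviliSereginSverak2009, §4 (arXiv:0709.3599 p. 8)] -/
theorem exists_singular_limit_slack_le {C K : ℝ}
    {W : ℝ → EuclideanSpace ℝ (Fin 3) → EuclideanSpace ℝ (Fin 3)} (hW : IsTypeIAncientMild C W)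
    (hlaw : ∀ s : ℝ, s < 0 → ∫⁻ x, ‖fderiv ℝ (W s) x‖ₑ ^ 2 ≤ ENNReal.ofReal (K / Real.sqrt (-s)))
    (hsing : ∀ r > 0, ∀ M : ℝ, ∃ t ∈ Ioo (-(r ^ 2)) (0 : ℝ),
      ∃ x ∈ ball (0 : EuclideanSpace ℝ (Fin 3)) r, M < ‖W t x‖) :
    ∃ V : ℝ → EuclideanSpace ℝ (Fin 3) → EuclideanSpace ℝ (Fin 3), IsTypeIAncientMild C V ∧
      (∀ s : ℝ, s < 0 → ∫⁻ x, ‖fderiv ℝ (V s) x‖ₑ ^ 2 ≤ ENNReal.ofReal (K / Real.sqrt (-s))) ∧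
      (∀ r > 0, ∀ M : ℝ, ∃ t ∈ Ioo (-(r ^ 2)) (0 : ℝ),
        ∃ x ∈ ball (0 : EuclideanSpace ℝ (Fin 3)) r, M < ‖V t x‖) ∧
      (∃ l : ℕ → ℝ, (∀ k, 0 < l k) ∧
        ∀ t < 0, ∀ x, Tendsto (fun k => nsRescale (l k) W t x) atTop (𝓝 (V t x))) ∧
      ∀ R : ℝ, 0 < R →
        2 * (∫ y, smoothTransition (2 - ‖y‖ ^ 2 / R ^ 2) *
          ((C - ‖V (-1) y‖) * ‖fderiv ℝ (curl (V (-1))) y (curl (V (-1)) y)‖)) ≤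
          (1 / 2) * max (C ^ 2 - 1) 0 * (‖curlCLM‖ ^ 2 * max K 0) := by
  set B₀ : ℝ := (1 / 2) * max (C ^ 2 - 1) 0 * (‖curlCLM‖ ^ 2 * max K 0) with hB₀
  -- ### times with small slack on growing cutoffs
  obtain ⟨L, hL0, hslack⟩ := exists_slack_lt_general hW hlaw
  set M : ℝ := ‖curlCLM‖ ^ 2 * max K 0 with hMdef
  have hsn : ∀ n : ℕ, ∃ s : ℝ,
      2 * (∫ y, smoothTransition (2 - ‖y‖ ^ 2 / ((n : ℝ) + 1) ^ 2) *
        ((C - ‖lerayOrbit W s y‖) * ‖fderiv ℝ (lerayVorticity W s) y (lerayVorticity W s y)‖)) <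
        B₀ + (L * M + 1) / ((n : ℝ) + 1) := by
    intro n
    have hn1 : (1 : ℝ) ≤ (n : ℝ) + 1 := by
      have : (0 : ℝ) ≤ n := n.cast_nonneg
      linarith
    obtain ⟨s, hs⟩ := hslack ((n : ℝ) + 1) hn1 (1 / ((n : ℝ) + 1)) (by positivity)
    refine ⟨s, hs.trans_le (le_of_eq ?_)⟩
    rw [hB₀, add_div]
    ring
  choose sn hsn using hsn
  -- ### the rescaled members
  set v : ℕ → ℝ → EuclideanSpace ℝ (Fin 3) → EuclideanSpace ℝ (Fin 3) := fun n =>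
    nsRescale (Real.exp (-(sn n) / 2)) W with hvdef
  have hμ : ∀ n, 0 < Real.exp (-(sn n) / 2) := fun n => Real.exp_pos _
  have hv : ∀ n, IsTypeIAncientMild C (v n) := fun n => hW.nsRescale (hμ n)
  have hvlaw : ∀ n, ∀ s : ℝ, s < 0 →
      ∫⁻ x, ‖fderiv ℝ (v n s) x‖ₑ ^ 2 ≤ ENNReal.ofReal (K / Real.sqrt (-s)) := fun n =>
    RecurrentReductionD.dissipationLaw_nsRescale hlaw (hμ n)
  have hvsing : ∀ n, ∀ r > 0, ∀ M : ℝ, ∃ t ∈ Ioo (-(r ^ 2)) (0 : ℝ),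
      ∃ x ∈ ball (0 : EuclideanSpace ℝ (Fin 3)) r, M < ‖v n t x‖ := fun n =>
    RecurrentReductionD.singularAtOrigin_nsRescale hsing (hμ n)
  -- their slack at similarity time `0`, on the cutoff `R`, for `n + 1 ≥ R`
  have hvslack : ∀ {R : ℝ}, 0 < R → ∀ n : ℕ, R ≤ (n : ℝ) + 1 →
      2 * (∫ y, smoothTransition (2 - ‖y‖ ^ 2 / R ^ 2) *
        ((C - ‖v n (-1) y‖) * ‖fderiv ℝ (curl (v n (-1))) y (curl (v n (-1)) y)‖)) <
        B₀ + (L * M + 1) / ((n : ℝ) + 1) := by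
    intro R hR n hn
    have h1 := slack_le_slack (hv n) hR hn 0
    rw [lerayVorticity_apply, lerayOrbit_zero] at h1
    have h2 : 2 * (∫ y, smoothTransition (2 - ‖y‖ ^ 2 / ((n : ℝ) + 1) ^ 2) *
        ((C - ‖lerayOrbit (v n) 0 y‖) *
          ‖fderiv ℝ (lerayVorticity (v n) 0) y (lerayVorticity (v n) 0 y)‖)) =
        2 * (∫ y, smoothTransition (2 - ‖y‖ ^ 2 / ((n : ℝ) + 1) ^ 2) *
          ((C - ‖lerayOrbit W (sn n) y‖) *
            ‖fderiv ℝ (lerayVorticity W (sn n)) y (lerayVorticity W (sn n) y)‖)) :=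
      slack_nsRescale_zero (C := C) W (sn n) ((n : ℝ) + 1)
    rw [lerayVorticity_apply, lerayOrbit_zero] at h2
    have h3 := hsn n
    rw [← h2] at h3
    exact h1.trans_lt h3
  -- ### compactness across members
  obtain ⟨ψ, hψ, V, hV, hunif, hpt, hgrad⟩ := Compactness.seqLimit hv
  have hψt : Tendsto ψ atTop atTop := hψ.tendsto_atTop
  have hVlaw : ∀ s : ℝ, s < 0 →
      ∫⁻ x, ‖fderiv ℝ (V s) x‖ₑ ^ 2 ≤ ENNReal.ofReal (K / Real.sqrt (-s)) :=
    Compactness.law_of_seqLimit (Kk := fun _ => K) (Kinf := K) hψt hvlaw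
      (fun ε hε => Eventually.of_forall fun k => by linarith) hgrad
  have hVsing := Compactness.persistent_singularity_seq (w := fun j => v (ψ j))
    (fun j => hv _) (fun j => hvlaw _) (fun j => hvsing _) hV hunif
  refine ⟨V, hV, hVlaw, hVsing, ⟨fun j => Real.exp (-(sn (ψ j)) / 2), fun j => hμ _,
    fun t ht x => hpt t ht x⟩, ?_⟩
  -- ### the limit's slack is at most `B₀` on every cutoff
  intro R hR
  have hzero :
      2 * (∫ y, smoothTransition (2 - ‖y‖ ^ 2 / R ^ 2) *
        ((C - ‖V (-1) y‖) * ‖fderiv ℝ (curl (V (-1))) y (curl (V (-1)) y)‖)) ≤ B₀ := by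
    have hlim := tendsto_slack_zero (fun j => hv (ψ j)) hV hunif hpt hgrad hR
    -- the bounds along the subsequence tend to `B₀`
    have hup : Tendsto (fun j => B₀ + (L * M + 1) / (((ψ j : ℕ) : ℝ) + 1)) atTop (𝓝 B₀) := by
      have h0 : Tendsto (fun j => 1 / ((((ψ j)) : ℝ) + 1)) atTop (𝓝 0) :=
        tendsto_one_div_add_atTop_nhds_zero_nat.comp hψt
      have e : (fun j => B₀ + (L * M + 1) / (((ψ j : ℕ) : ℝ) + 1)) =
          fun j => B₀ + (L * M + 1) * (1 / (((ψ j : ℕ) : ℝ) + 1)) := by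
        funext j; rw [div_eq_mul_one_div]
      rw [e]
      have h := (h0.const_mul (L * M + 1)).const_add B₀
      rwa [mul_zero, add_zero] at h
    have hev : ∀ᶠ j in atTop, R ≤ ((ψ j : ℕ) : ℝ) + 1 := by
      have h1 : Tendsto (fun j => ((ψ j : ℕ) : ℝ) + 1) atTop atTop :=
        tendsto_atTop_add_const_right _ 1 (tendsto_natCast_atTop_atTop.comp hψt)
      exact h1.eventually_ge_atTop R
    have hle : ∀ᶠ j in atTop,
        2 * (∫ y, smoothTransition (2 - ‖y‖ ^ 2 / R ^ 2) *
          ((C - ‖v (ψ j) (-1) y‖) * ‖fderiv ℝ (curl (v (ψ j) (-1))) y (curl (v (ψ j) (-1)) y)‖)) ≤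
          B₀ + (L * M + 1) / (((ψ j : ℕ) : ℝ) + 1) := by
      filter_upwards [hev] with j hj
      exact (hvslack hR (ψ j) hj).le
    exact le_of_tendsto_of_tendsto hlim hup hle
  exact hzero

end Summit.NavierStokesRegularity.NavierStokesRegularity.Theorems.FiniteDissipationLiouville.ThresholdOne

end
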